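import Summits.CriticalPhenomena.PercolationContinuityZ3.Theorems.Transplant.AutChartOrbitsCriticalContinuity
import Summits.CriticalPhenomena.PercolationContinuityZ3.Theorems.Transplant.SkelPhiPsiSteps
import Literature.Probability.Percolation.CoveringQuotientTwoLifts
import HarnessLib

/-!
# Good coordinates for an action with FINITELY MANY ORBITS (Kozma–Nitzan's Lemma 8 / Martineau–Tassion's good coordinates WITHOUT transitivity):
# max-area re-basing over the displacements seen within a bounded distance of a transversal gives an `N`-Lipschitz equivariant chart with
# TIGHT QUASI-STEPS `± N eᵢ` at every representative — NO step hypothesis; and its coarse chart has the lane's `Skelφ.PsiSteps`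

builds on p205010 (kernel theorem, internal audit signed; external expert review pending) — nothing in this file uses p205010 and nothing here is a
percolation statement.  Lane `prim-bschramm`, seat `prim-bschramm-p3` gen 28 (design owner; P3-NILPOTENT §20.6: the CUSTOMER SIDE of the path-step rung
(N3-b) is free).  Helper file (`--supports stmt-CriticalPhenomena-4575 --as helper`).  Nothing is claimed about any node; the path-step / quasi-step
From machinery that would consume this is NOT in the tree and is the planners' call.

WHY.  «AutChartOrbitsCriticalContinuity» (this seat, p493117) needs, besides finitely many orbits and a character killing a stabiliser, SINGLE-EDGE axis
steps `± N eᵢ` at every representative and an `N`-bound on the edge values — with one orbit both come for free from a rank-two character by max-area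
re-basing over the movers of one vertex (p4-g25 «AutChartCriticalContinuity»), with several orbits they can fail («PlanarSkeletonStepObstruction»; P3-NILPOTENT
§20.3).  What NEVER fails is the version with steps along WALKS OF BOUNDED LENGTH whose chart track stays within sup-distance `N` of the start (TIGHT
QUASI-STEPS): re-base on a maximal-area pair of the finite, symmetric set `U_R` of chart values seen within distance `R` of the representatives (zero-offset
chart), `R = R₀ + D` large enough to see an independent pair from every representative; every vertex of a realising walk is within `R` of a representative,
so its chart lies in `U_R`, whose re-based sup-norms are `≤ N = |det|` by maximality.
* §1 `AutChart.ochart` — the zero-offset chart `w ↦ c (osec w)` of a character w.r.t. a transversal: equivariant, `0` on the representatives; `dispSet R`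
  (= `U_R`), monotone, SYMMETRIC (`neg_mem_dispSet`: `w = a • r' ∈ B(r, R)` ⟹ `a⁻¹ • r ∈ B(r', R)` has the opposite value), contains the edge values
  (`R ≥ 1`) and is reached from EVERY representative with a walk all of whose vertices have chart in `dispSet R` (`exists_walk_of_mem_dispSet`, length
  `≤ R + D`);
* §2 **`AutChart.exists_goodCoordinates_of_finite_orbits`**: `∃ u v M`, `det(u,v) ≠ 0`, every edge value re-based into the sup-ball of radius `|det(u,v)|`,
  and at every representative, for every axis and sign, a walk of length `≤ M` to a vertex `a • r'` with re-based value EXACTLY `± |det| eᵢ` whose every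
  vertex has re-based chart of sup-norm `≤ |det|`;
* §3 **`AutChart.exists_lip_psiSteps_of_finite_orbits`**: hence a chart `ψ : V → ℤ²` (the coarse chart `⌊rebase φ / N⌋`), `1`-Lipschitz along edges
  (`Skelφ.Lip`), with **`Skelφ.PsiSteps G ψ M`** (the lane's LEVEL-1 quasi-step currency, «SkelPhiPsiSteps») and translated by every `a` whose re-based value
  lies in `N ℤ²` — the exact shape a path-step From carrier would read.
[cite: KozmaNitzan2024, §4 p. 16 (Lemma 8)] [cite: MartineauTassion2017, §3.2 (good coordinates)] [cite: BenjaminiSchramm1996, §2 (almost transitive graphs)]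
-/

noncomputable section

namespace Summit.CriticalPhenomena.PercolationContinuityZ3.Theorems.Transplant

open SimpleGraph Filter Literature.Barriers.CriticalPhenomena Literature.Probability.LatticeModels Literature.Probability.Percolation
open scoped Classical

namespace AutChart

variable {V : Type} {G : SimpleGraph V} {A : Type} [Group A] [MulAction A V] [G.LocallyFinite] {reps : Finset V}

/-! ## §1 The zero-offset chart of a character and the displacement sets `U_R` -/

/-- **The zero-offset chart** of a character w.r.t. a covering transversal: `φ₀ w := c (osec w)`. [folklore] -/
def ochart (hcover : ∀ w : V, ∃ a : A, ∃ r ∈ reps, a • r = w) (c : A →* Multiplicative (Site 2)) (w : V) : Site 2 :=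
  Multiplicative.toAdd (c (osec hcover w))

section Chart

variable (hcover : ∀ w : V, ∃ a : A, ∃ r ∈ reps, a • r = w) (htrans : ∀ r ∈ reps, ∀ r' ∈ reps, ∀ a : A, a • r = r' → r = r')
  (c : A →* Multiplicative (Site 2)) (hstab : ∀ (v : V), ∀ h ∈ MulAction.stabilizer A v, c h = 1)
include htrans hstab

omit [G.LocallyFinite] in
/-- **Equivariance**: `φ₀ (a • w) = c a + φ₀ w`. [folklore] -/
theorem ochart_smul (a : A) (w : V) : ochart hcover c (a • w) = Multiplicative.toAdd (c a) + ochart hcover c w := by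
  unfold ochart
  have h : ((osec hcover (a • w))⁻¹ * (a * osec hcover w)) • otyp hcover w = otyp hcover w := by
    rw [mul_smul, mul_smul, osec_smul, inv_smul_eq_iff, ← otyp_smul hcover htrans a w, osec_smul]
  have h0 := hstab _ _ (MulAction.mem_stabilizer_iff.2 h)
  rw [map_mul, map_mul, map_inv, inv_mul_eq_one] at h0
  rw [h0, toAdd_mul]

omit [G.LocallyFinite] in
/-- `φ₀ = 0` on the representatives. [folklore] -/
theorem ochart_of_mem {r : V} (hr : r ∈ reps) : ochart hcover c r = 0 := by
  unfold ochart
  have h : osec hcover r ∈ MulAction.stabilizer A r := by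
    rw [MulAction.mem_stabilizer_iff]
    have h := osec_smul hcover r
    rwa [otyp_of_mem hcover htrans hr] at h
  rw [hstab r _ h, toAdd_one]

omit [G.LocallyFinite] in
/-- `φ₀ (a • r) = c a` for a representative `r`. [folklore] -/
theorem ochart_smul_of_mem (a : A) {r : V} (hr : r ∈ reps) : ochart hcover c (a • r) = Multiplicative.toAdd (c a) := by
  rw [ochart_smul hcover htrans c hstab, ochart_of_mem hcover htrans c hstab hr, add_zero]

end Chart

/-- **The displacement set `U_R`**: the chart values of the vertices within distance `R` of the representatives. [this work] -/
def dispSet (hcover : ∀ w : V, ∃ a : A, ∃ r ∈ reps, a • r = w) (c : A →* Multiplicative (Site 2)) (R : ℕ) : Finset (Site 2) :=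
  (reps.biUnion fun r => (graphBall_finite G r R).toFinset).image (ochart hcover c)

section Disp

variable (hcover : ∀ w : V, ∃ a : A, ∃ r ∈ reps, a • r = w) (c : A →* Multiplicative (Site 2))

/-- Membership in `U_R`. [this work] -/
theorem mem_dispSet {R : ℕ} {r w : V} (hr : r ∈ reps) (hw : w ∈ graphBall G r R) : ochart hcover c w ∈ dispSet (G := G) hcover c R :=
  Finset.mem_image.2 ⟨w, Finset.mem_biUnion.2 ⟨r, hr, (Set.Finite.mem_toFinset _).2 hw⟩, rfl⟩

/-- Elements of `U_R` are chart values of vertices near representatives. [this work] -/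
theorem exists_of_mem_dispSet {R : ℕ} {x : Site 2} (hx : x ∈ dispSet (G := G) hcover c R) :
    ∃ r ∈ reps, ∃ w ∈ graphBall G r R, ochart hcover c w = x := by
  obtain ⟨w, hw, rfl⟩ := Finset.mem_image.1 hx
  obtain ⟨r, hr, hw⟩ := Finset.mem_biUnion.1 hw
  exact ⟨r, hr, w, (Set.Finite.mem_toFinset _).1 hw, rfl⟩

/-- `U_R` is monotone in `R`. [this work] -/
theorem dispSet_mono {R R' : ℕ} (h : R ≤ R') : dispSet (G := G) hcover c R ⊆ dispSet (G := G) hcover c R' := by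
  intro x hx
  obtain ⟨r, hr, w, hw, rfl⟩ := exists_of_mem_dispSet hcover c hx
  exact mem_dispSet hcover c hr (graphBall_mono _ _ h hw)

/-- **`U_R` is SYMMETRIC**: if `w = a • r' ∈ B(r, R)` has value `x = c a`, then `a⁻¹ • r ∈ B(r', R)` has value `−x`. [this work] -/
theorem neg_mem_dispSet (hact : IsActionByAut G A) (htrans : ∀ r ∈ reps, ∀ r' ∈ reps, ∀ a : A, a • r = r' → r = r')
    (hstab : ∀ (v : V), ∀ h ∈ MulAction.stabilizer A v, c h = 1) {R : ℕ} {x : Site 2} (hx : x ∈ dispSet (G := G) hcover c R) :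
    -x ∈ dispSet (G := G) hcover c R := by
  obtain ⟨r, hr, w, hw, rfl⟩ := exists_of_mem_dispSet hcover c hx
  obtain ⟨a, r', hr', rfl⟩ := hcover w
  have hmem : a⁻¹ • r ∈ graphBall G r' R := by
    have h1 : r ∈ graphBall G (a • r') R := (mem_graphBall_comm G).1 hw
    have h2 := (smul_mem_graphBall_iff hact a⁻¹ (x := a • r') (y := r) (n := R)).2 h1
    rwa [inv_smul_smul] at h2
  have e : ochart hcover c (a⁻¹ • r) = -ochart hcover c (a • r') := by
    rw [ochart_smul_of_mem hcover htrans c hstab a⁻¹ hr, ochart_smul_of_mem hcover htrans c hstab a hr', map_inv, toAdd_inv]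
  rw [← e]
  exact mem_dispSet hcover c hr' hmem

/-- Edge values lie in `U_R` for `R ≥ 1`. [this work] -/
theorem toAdd_mem_dispSet_of_adj (htrans : ∀ r ∈ reps, ∀ r' ∈ reps, ∀ a : A, a • r = r' → r = r')
    (hstab : ∀ (v : V), ∀ h ∈ MulAction.stabilizer A v, c h = 1) {R : ℕ} (hR : 1 ≤ R) {r r' : V} (hr : r ∈ reps) (hr' : r' ∈ reps) {a : A} (ha : G.Adj r (a • r')) :
    Multiplicative.toAdd (c a) ∈ dispSet (G := G) hcover c R := by
  rw [← ochart_smul_of_mem hcover htrans c hstab a hr']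
  exact mem_dispSet hcover c hr (graphBall_mono _ _ hR (mem_graphBall_one_of_adj G ha))

/-- **Every value of `U_R` is reached from EVERY representative by a walk of length `≤ D + R` all of whose vertices have chart in `U_R`** (`D ≤ R` a bound
for the distances between representatives: go to the representative that sees the value, then to the vertex). [this work] -/
theorem exists_walk_of_mem_dispSet (htrans : ∀ r ∈ reps, ∀ r' ∈ reps, ∀ a : A, a • r = r' → r = r')
    (hstab : ∀ (v : V), ∀ h ∈ MulAction.stabilizer A v, c h = 1) {R D : ℕ} (hDR : D ≤ R) (hD : ∀ r ∈ reps, ∀ r' ∈ reps, r' ∈ graphBall G r D)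
    {x : Site 2} (hx : x ∈ dispSet (G := G) hcover c R) {r₀ : V} (hr₀ : r₀ ∈ reps) :
    ∃ (a : A) (r' : V) (p : G.Walk r₀ (a • r')), r' ∈ reps ∧ p.length ≤ D + R ∧ Multiplicative.toAdd (c a) = x ∧
      ∀ y ∈ p.support, ochart hcover c y ∈ dispSet (G := G) hcover c R := by
  obtain ⟨r, hr, w, hw, rfl⟩ := exists_of_mem_dispSet hcover c hx
  obtain ⟨a, r', hr', rfl⟩ := hcover w
  obtain ⟨p₁, hp₁⟩ := hD r₀ hr₀ r hr
  obtain ⟨p₂, hp₂⟩ := hw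
  refine ⟨a, r', p₁.append p₂, hr', by rw [Walk.length_append]; omega, (ochart_smul_of_mem hcover htrans c hstab a hr').symm, fun y hy => ?_⟩
  rw [Walk.support_append, List.mem_append] at hy
  rcases hy with hy | hy
  · obtain ⟨q, hq⟩ := support_subset_graphBall_start p₁ hy
    exact mem_dispSet hcover c hr₀ ⟨q, by omega⟩
  · obtain ⟨q, hq⟩ := support_subset_graphBall_start p₂ (List.mem_of_mem_tail hy)
    exact mem_dispSet hcover c hr ⟨q, by omega⟩

end Disp

/-! ## §2 Good coordinates: `N`-bounded edge values and TIGHT QUASI-STEPS at every representative -/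

/-- **GOOD COORDINATES FOR FINITELY MANY ORBITS** (Kozma–Nitzan Lemma 8 without transitivity).  `G` connected, locally finite; `A` acting by automorphisms with
finitely many orbits (transversal `reps`); `c : A → ℤ²` killing one stabiliser, of rank two.  Then there are an independent pair `u, v` and a length `M` such that,
writing `N = |det(u,v)|` and re-basing on `(u, v)`: (i) every edge value `c a` (`r ∼ a • r'`, `r, r' ∈ reps`) has re-based sup-norm `≤ N`; (ii) at every
representative `r`, for every axis `i` and sign `σ`, some `a • r'` (`r' ∈ reps`) with re-based value EXACTLY `N σ eᵢ` is joined to `r` by a walk of length `≤ M`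
along which the re-based chart has sup-norm `≤ N` (a TIGHT QUASI-STEP).  No step hypothesis. [cite: KozmaNitzan2024, §4 p. 16 (Lemma 8)]
[cite: MartineauTassion2017, §3.2 (good coordinates)] -/
theorem exists_goodCoordinates_of_finite_orbits (hact : IsActionByAut G A) (hc : G.Connected) (reps : Finset V)
    (htrans : ∀ r ∈ reps, ∀ r' ∈ reps, ∀ a : A, a • r = r' → r = r') (hcover : ∀ w : V, ∃ a : A, ∃ r ∈ reps, a • r = w)
    (c : A →* Multiplicative (Site 2)) {t : V} (hstab : ∀ h ∈ MulAction.stabilizer A t, c h = 1)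
    (hrank : ∃ a b : A, MaxArea.det2 (Multiplicative.toAdd (c a)) (Multiplicative.toAdd (c b)) ≠ 0) :
    ∃ (u v : Site 2) (M : ℕ), MaxArea.det2 u v ≠ 0 ∧
      (∀ r ∈ reps, ∀ r' ∈ reps, ∀ a : A, G.Adj r (a • r') → ∀ i : Fin 2, |MaxArea.rebase u v (Multiplicative.toAdd (c a)) i| ≤ |MaxArea.det2 u v|) ∧
      (∀ r ∈ reps, ∀ (i : Fin 2) (σ : ℤˣ), ∃ (a : A) (r' : V) (p : G.Walk r (a • r')), r' ∈ reps ∧ p.length ≤ M ∧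
        MaxArea.rebase u v (Multiplicative.toAdd (c a)) = Pi.single i (|MaxArea.det2 u v| * σ) ∧
        ∀ y ∈ p.support, ∀ j : Fin 2, |MaxArea.rebase u v (ochart hcover c y) j| ≤ |MaxArea.det2 u v|) := by
  have hstab' : ∀ (v : V), ∀ h ∈ MulAction.stabilizer A v, c h = 1 := map_stabilizer_eq_one_of_one hact hc c hstab
  -- a common bound `D` for the distances between representatives
  have hdist : ∀ r r' : V, ∃ d : ℕ, r' ∈ graphBall G r d := fun r r' => by
    obtain ⟨w⟩ := hc.preconnected r r'
    exact ⟨w.length, w, le_rfl⟩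
  choose d hd using hdist
  set D : ℕ := reps.sup fun r => reps.sup fun r' => d r r' with hD_def
  have hD : ∀ r ∈ reps, ∀ r' ∈ reps, r' ∈ graphBall G r D := fun r hr r' hr' =>
    graphBall_mono _ _ (le_trans (Finset.le_sup (f := fun r'' => d r r'') hr') (Finset.le_sup (f := fun r => reps.sup fun r'' => d r r'') hr)) (hd r r')
  -- a radius `R₀` at which the representative of `t` sees the rank-two pair
  obtain ⟨a₀, b₀, hab⟩ := hrank
  obtain ⟨g, r₀, hr₀, rfl⟩ := hcover t
  set R : ℕ := max (max (d r₀ (a₀ • r₀)) (d r₀ (b₀ • r₀))) 1 + D with hR_def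
  have hR1 : 1 ≤ R := by omega
  have hDR : D ≤ R := by omega
  have haU : Multiplicative.toAdd (c a₀) ∈ dispSet (G := G) hcover c R := by
    rw [← ochart_smul_of_mem hcover htrans c hstab' a₀ hr₀]
    exact mem_dispSet hcover c hr₀ (graphBall_mono _ _ (by omega) (hd r₀ (a₀ • r₀)))
  have hbU : Multiplicative.toAdd (c b₀) ∈ dispSet (G := G) hcover c R := by
    rw [← ochart_smul_of_mem hcover htrans c hstab' b₀ hr₀]
    exact mem_dispSet hcover c hr₀ (graphBall_mono _ _ (by omega) (hd r₀ (b₀ • r₀)))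
  obtain ⟨u, hu, v, hv, hD0, hAu, hAv, hbd⟩ := MaxArea.exists_rebase (dispSet (G := G) hcover c R) ⟨_, haU, _, hbU, hab⟩
  refine ⟨u, v, D + R, hD0, fun r hr r' hr' a ha i => hbd _ (toAdd_mem_dispSet_of_adj hcover c htrans hstab' hR1 hr hr' ha) i, ?_⟩
  intro r hr i σ
  -- the target value `± u` / `± v` lies in the symmetric set `U_R`
  obtain ⟨x, hxU, hxval⟩ : ∃ x ∈ dispSet (G := G) hcover c R,
      MaxArea.rebase u v x = Pi.single i (|MaxArea.det2 u v| * (σ : ℤ)) := by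
    rcases Int.units_eq_one_or σ with rfl | rfl
    · refine ⟨if i = 0 then u else v, ?_, ?_⟩ <;> fin_cases i <;> simp [hu, hv, hAu, hAv]
    · refine ⟨-(if i = 0 then u else v), ?_, ?_⟩ <;> fin_cases i <;>
        simp [neg_mem_dispSet hcover c hact htrans hstab' hu, neg_mem_dispSet hcover c hact htrans hstab' hv, MaxArea.rebase_neg, hAu, hAv, Pi.single_neg]
  obtain ⟨a, r', p, hr', hlen, hca, hsupp⟩ := exists_walk_of_mem_dispSet hcover c htrans hstab' hDR hD hxU hr
  exact ⟨a, r', p, hr', hlen, by rw [hca, hxval], fun y hy j => hbd _ (hsupp y hy) j⟩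

omit [G.LocallyFinite] in
/-- The support of a translated walk is the translate of the support. [folklore] -/
theorem exists_mem_support_of_map_smul (hact : IsActionByAut G A) (b : A) {x y : V} (p : G.Walk x y) {z : V}
    (hz : z ∈ (p.map (smulIso hact b).toHom).support) : ∃ z₀ ∈ p.support, b • z₀ = z := by
  induction p with
  | nil =>
    rw [Walk.map_nil, Walk.support_nil, List.mem_singleton] at hz
    exact ⟨_, Walk.start_mem_support _, hz.symm⟩
  | cons h q ih =>
    rw [Walk.map_cons, Walk.support_cons, List.mem_cons] at hz
    rcases hz with hz | hz
    · exact ⟨_, Walk.start_mem_support _, hz.symm⟩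
    · obtain ⟨z₀, hz₀, rfl⟩ := ih hz
      exact ⟨z₀, by rw [Walk.support_cons]; exact List.mem_cons_of_mem _ hz₀, rfl⟩

/-! ## §3 The coarse chart: `1`-Lipschitz with `Skelφ.PsiSteps` -/

/-- Floor division by `N ≥ 1` moves by at most one when the argument moves by at most `N`. [folklore] -/
theorem ediv_sub_ediv_le {N : ℤ} (hN : 0 < N) {x y : ℤ} (h : |x - y| ≤ N) : |x / N - y / N| ≤ 1 := by
  rw [abs_le] at h ⊢
  obtain ⟨h1, h2⟩ := h
  have hx1 : x / N ≤ (y + N) / N := Int.ediv_le_ediv hN (by omega)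
  have hx2 : (y - N) / N ≤ x / N := Int.ediv_le_ediv hN (by omega)
  rw [show y + N = y + N * 1 by ring, Int.add_mul_ediv_left _ _ hN.ne'] at hx1
  rw [show y - N = y + N * (-1) by ring, Int.add_mul_ediv_left _ _ hN.ne'] at hx2
  constructor <;> omega

/-- **THE COARSE CHART OF GOOD COORDINATES** (customer side of the path-step rung, P3-NILPOTENT §20.6): under the hypotheses of
`exists_goodCoordinates_of_finite_orbits` there are a chart `ψ : V → ℤ²`, a scale `N ≥ 1`, a re-based character `c'` and a length `M` with: `ψ` is
`1`-Lipschitz along edges (`Skelφ.Lip`); `ψ` has the lane's quasi-steps **`Skelφ.PsiSteps G ψ M`** (in every direction a vertex one `ψ`-unit away joined by a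
walk of length `≤ M` whose `ψ`-track stays in the hull of the endpoints widened by one); and `ψ (a • w) = ψ w + k` whenever the re-based value of `a` is `N k`
(in particular for the quasi-step movers).  `ψ = ⌊φ' / N⌋` for the re-based zero-offset chart `φ'`. [cite: KozmaNitzan2024, §4 p. 16 (Lemma 8)]
[cite: MartineauTassion2017, §3.2] -/
theorem exists_lip_psiSteps_of_finite_orbits (hact : IsActionByAut G A) (hc : G.Connected) (reps : Finset V)
    (htrans : ∀ r ∈ reps, ∀ r' ∈ reps, ∀ a : A, a • r = r' → r = r') (hcover : ∀ w : V, ∃ a : A, ∃ r ∈ reps, a • r = w)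
    (c : A →* Multiplicative (Site 2)) {t : V} (hstab : ∀ h ∈ MulAction.stabilizer A t, c h = 1)
    (hrank : ∃ a b : A, MaxArea.det2 (Multiplicative.toAdd (c a)) (Multiplicative.toAdd (c b)) ≠ 0) :
    ∃ (ψ : V → Site 2) (N : ℕ) (c' : A →* Multiplicative (Site 2)) (M : ℕ), 1 ≤ N ∧ Skelφ.Lip G ψ ∧ Skelφ.PsiSteps G ψ M ∧
      (∀ (a : A) (k : Site 2), Multiplicative.toAdd (c' a) = (fun j => (N : ℤ) * k j) → ∀ w : V, ψ (a • w) = ψ w + k) ∧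
      (∀ r ∈ reps, ∀ (i : Fin 2) (σ : ℤˣ), ∃ a : A, Multiplicative.toAdd (c' a) = Pi.single i ((N : ℤ) * σ)) := by
  have hstab' : ∀ (v : V), ∀ h ∈ MulAction.stabilizer A v, c h = 1 := map_stabilizer_eq_one_of_one hact hc c hstab
  obtain ⟨u, v, M, hD0, hlip, hstep⟩ := exists_goodCoordinates_of_finite_orbits hact hc reps htrans hcover c hstab hrank
  set N : ℕ := (MaxArea.det2 u v).natAbs with hN_def
  have hNZ : ((N : ℕ) : ℤ) = |MaxArea.det2 u v| := Int.natCast_natAbs _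
  have hN : (0 : ℤ) < N := by rw [hNZ]; exact abs_pos.2 hD0
  set c' : A →* Multiplicative (Site 2) := (rebaseHom u v).comp c with hc'_def
  have hc' : ∀ a, Multiplicative.toAdd (c' a) = MaxArea.rebase u v (Multiplicative.toAdd (c a)) := fun a => rfl
  -- the re-based zero-offset chart and its coarse chart
  set φ' : V → Site 2 := fun w => MaxArea.rebase u v (ochart hcover c w) with hφ'_def
  have hφ'_smul : ∀ (a : A) (w : V), φ' (a • w) = MaxArea.rebase u v (Multiplicative.toAdd (c a)) + φ' w := fun a w => by
    simp only [hφ'_def, ochart_smul hcover htrans c hstab', MaxArea.rebase_add]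
  have hφ'_rep : ∀ r ∈ reps, φ' r = 0 := fun r hr => by
    simp only [hφ'_def, ochart_of_mem hcover htrans c hstab' hr, MaxArea.rebase_zero]
  set ψ : V → Site 2 := fun w j => φ' w j / (N : ℤ) with hψ_def
  refine ⟨ψ, N, c', M, Int.natAbs_pos.2 hD0, ?_, ?_, ?_, ?_⟩
  · -- `1`-Lipschitz: every edge is a translate of an edge at a representative, whose re-based value has sup-norm `≤ N`
    intro x y hxy j
    obtain ⟨b, r, hr, rfl⟩ := hcover x
    have hadj : G.Adj r (b⁻¹ • y) := by
      have h := (hact b⁻¹ (b • r) y).2 hxy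
      rwa [inv_smul_smul] at h
    obtain ⟨a, r', hr', hy⟩ := hcover (b⁻¹ • y)
    have hy' : y = (b * a) • r' := by rw [mul_smul, hy, smul_inv_smul]
    have hval := hlip r hr r' hr' a (by rw [hy]; exact hadj) j
    have e : φ' (b • r) j - φ' y j = -(MaxArea.rebase u v (Multiplicative.toAdd (c a)) j) := by
      rw [hy', hφ'_smul, hφ'_smul, hφ'_rep r hr, hφ'_rep r' hr', map_mul, toAdd_mul, MaxArea.rebase_add]
      simp only [Pi.add_apply, Pi.zero_apply, add_zero]
      ring
    show |φ' (b • r) j / (N : ℤ) - φ' y j / (N : ℤ)| ≤ 1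
    refine ediv_sub_ediv_le hN ?_
    rw [e, abs_neg, hNZ]
    exact hval
  · -- quasi-steps: translate the representative's tight walk
    intro w i σ
    obtain ⟨b, r, hr, rfl⟩ := hcover w
    obtain ⟨a, r', p, hr', hlen, hval, hsupp⟩ := hstep r hr i σ
    have hlen' : (p.map (smulIso hact b).toHom).length ≤ M := by rw [Walk.length_map]; exact hlen
    refine ⟨b • (a • r'), ?_, p.map (smulIso hact b).toHom, hlen', fun y hy => ?_⟩
    · funext j
      show φ' (b • (a • r')) j / (N : ℤ) = φ' (b • r) j / (N : ℤ) + (Pi.single i (σ : ℤ) : Site 2) j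
      rw [hφ'_smul, hφ'_smul, hφ'_smul, hφ'_rep r hr, hφ'_rep r' hr', hval, add_zero, add_zero, Pi.add_apply, ← hNZ]
      by_cases hj : j = i
      · subst hj
        rw [Pi.single_eq_same, Pi.single_eq_same, Int.add_mul_ediv_left _ _ hN.ne']
      · rw [Pi.single_eq_of_ne hj, Pi.single_eq_of_ne hj, add_zero, add_zero]
    · -- `y = b • y₀` with `y₀` on the representative's walk: `φ' y = rebase (c b) + φ' y₀`, `‖φ' y₀‖ ≤ N`
      obtain ⟨y₀, hy₀, rfl⟩ := exists_mem_support_of_map_smul hact b p hy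
      have hb0 : ∀ j, |φ' y₀ j| ≤ (N : ℤ) := fun j => by rw [hNZ]; exact hsupp y₀ hy₀ j
      intro j
      show min (φ' (b • r) j / (N : ℤ)) (φ' (b • (a • r')) j / (N : ℤ)) - 1 ≤ φ' (b • y₀) j / (N : ℤ) ∧
        φ' (b • y₀) j / (N : ℤ) ≤ max (φ' (b • r) j / (N : ℤ)) (φ' (b • (a • r')) j / (N : ℤ)) + 1
      rw [hφ'_smul b r, hφ'_rep r hr, add_zero, hφ'_smul b y₀]
      have h1 : |(MaxArea.rebase u v (Multiplicative.toAdd (c b)) + φ' y₀) j / (N : ℤ) -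
          MaxArea.rebase u v (Multiplicative.toAdd (c b)) j / (N : ℤ)| ≤ 1 :=
        ediv_sub_ediv_le hN (by rw [Pi.add_apply, add_sub_cancel_left]; exact hb0 j)
      rw [abs_le] at h1
      constructor
      · have := min_le_left (MaxArea.rebase u v (Multiplicative.toAdd (c b)) j / (N : ℤ)) (φ' (b • (a • r')) j / (N : ℤ)); omega
      · have := le_max_left (MaxArea.rebase u v (Multiplicative.toAdd (c b)) j / (N : ℤ)) (φ' (b • (a • r')) j / (N : ℤ)); omega
  · -- translation by elements of re-based value in `N ℤ²`
    intro a k hk w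
    funext j
    show φ' (a • w) j / (N : ℤ) = φ' w j / (N : ℤ) + k j
    rw [hφ'_smul, ← hc', hk]
    show ((N : ℤ) * k j + φ' w j) / (N : ℤ) = φ' w j / (N : ℤ) + k j
    rw [add_comm, Int.add_mul_ediv_left _ _ hN.ne']
  · intro r hr i σ
    obtain ⟨a, -, -, -, -, hval, -⟩ := hstep r hr i σ
    refine ⟨a, ?_⟩
    rw [hc', hval, hNZ]

end AutChart

end Summit.CriticalPhenomena.PercolationContinuityZ3.Theorems.Transplant

end
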